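import Summits.CriticalPhenomena.PercolationContinuityZ3.Theorems.Transplant.KNCells2Steps
import Summits.CriticalPhenomena.PercolationContinuityZ3.Theorems.Transplant.KNCellsStepsFail
import HarnessLib

/-!
# F8 (generic, LAG-1 ANCHORS), part 8 — (33) for `scheme₂`: the failure bound of one examination with BOTH anchors fixed by the history
# (Kozma–Nitzan's Step IV verbatim; replaces the anchor partition / pattern-pinned corridor of `KNCellsStepsFail`/`KNCellsStepsReach`, whose
# corridor hypothesis was unsatisfiable — design HOME/prim-bschramm-p2-g2/F8-DESIGN.md §7)

builds on p205010 (kernel theorem, internal audit signed; external expert review pending) — nothing in this file uses p205010.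
Lane `prim-bschramm`, seat `prim-bschramm-p2`; helper file (`--supports stmt-CriticalPhenomena-4575`).

* `obs_env₂_agree`, `cond_obs_env₂_iff` — the conditions read the same off the observation of the new envelope `env₂` and of the old
  `env` (both contain the conditioned edges), so the events `badA`, `Bev` of `KNCellsStepsDefs` (stated with `env`) serve unchanged;
* `not_succ₂_subset` — a failed examination has an onward direction bad at `(α, β)`;
* **`fail_bound₂`** — after a `Valid₂` history: the face-prefix consequences (I3) and the target lemma at the faces (I2) at `(α, β)` and the
  CORRIDOR BOUND `1 - ε' < P_{Wfull h e α β du}(Reach h e α β du)` for every onward `du` (KN's `reach_bound` shape — plain Lemma 12 under `μ`,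
  `E_{v,x}` random) give `P_p(¬succ₂) ≤ 4((1-δ₂)^K + ε')`.
[cite: KozmaNitzan2024, §4 pp. 28–31 ((33), Steps I–IV) — the ℤ^d model] [cite: GrimmettPercolation1999, §7.2]
-/

noncomputable section

open MeasureTheory ProbabilityTheory
open scoped ENNReal Classical

namespace Summit.CriticalPhenomena.PercolationContinuityZ3.Theorems

namespace Transplant

namespace KNCells

open Literature.Probability.Percolation Literature.Probability.LatticeModels SimpleGraph GadgetSystem ProbeHistory HSiteScheme Contour
open Literature.Probability.Percolation.KozmaNitzan (forall_not_of_not_jIdx)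

variable {V : Type*} [DecidableEq V]

namespace KSchA

variable {A : Type*} {G : SimpleGraph V} [G.LocallyFinite] {S : KSchA V A} {FD : FaceData V A}
variable {h : ProbeHistory V} {e : Site 2 × MDir} {a a' : A} (ha' : a' ∈ S.Γ.anchSet a (tgt e)) {du : MDir}

/-! ## The two envelopes read the same conditions -/

include ha' in
/-- The observations of `env₂` and of `env` agree on the fresh conditioned edges of level `j < K` of an onward direction. [folklore] -/
theorem obs_env₂_agree (hdu : du ∈ S.onward G h (tgt e)) {j : ℕ} (hj : j < S.Γ.K) (ω : BondConfig V) :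
    ∀ x ∈ S.Fj G h e a a' du j \ S.F G h, x ∈ obs ω (S.env₂ G h e a a') ↔ x ∈ obs ω (S.env G h e a) := by
  intro x hx
  have h1 : x ∈ S.env₂ G h e a a' := S.Fj_sdiff_subset_env₂ h e a a' hdu hj hx
  have h2 : x ∈ S.env G h e a := S.Fj_sdiff_subset_env h e a ha' hdu hj hx
  simp only [mem_obs_iff, h1, h2, true_and]

include ha' in
/-- (30) reads the same off either envelope. [folklore] -/
theorem cond_obs_env₂_iff (hdu : du ∈ S.onward G h (tgt e)) {j : ℕ} (hj : j < S.Γ.K) (ω : BondConfig V) :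
    S.cond G h e a a' du j (obs ω (S.env₂ G h e a a')) ↔ S.cond G h e a a' du j (obs ω (S.env G h e a)) :=
  S.cond_congr h e a a' du j (obs_env₂_agree ha' hdu hj ω)

include ha' in
/-- **A failed examination has an onward direction that is bad at the fixed anchors.** [cite: KozmaNitzan2024, §4 p. 27 (j_x), p. 31] -/
theorem not_succ₂_subset :
    {ω | ¬S.succ₂ G h e a a' ((S.probe₂ G h e a a').read ω)} ⊆ ⋃ du ∈ S.onward G h (tgt e), S.badA G h e a a' du := by
  intro ω hω
  simp only [Set.mem_setOf_eq, S.succ₂_read_iff] at hω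
  simp only [succ₂] at hω
  push Not at hω
  obtain ⟨du, hdu, hc⟩ := hω
  simp only [Set.mem_iUnion, exists_prop]
  refine ⟨du, hdu, ?_⟩
  -- all levels are bad when read off `env₂`, hence when read off `env`
  have hall : ∀ j < S.Γ.K, ¬S.cond G h e a a' du j (obs ω (S.env₂ G h e a a')) :=
    forall_not_of_not_jIdx (P := fun j => S.cond G h e a a' du j (obs ω (S.env₂ G h e a a'))) S.Γ.hK hc
  intro j hj
  rw [← cond_obs_env₂_iff ha' hdu hj]
  exact hall j hj

variable [Countable V]

include ha' in
/-- **(33) with lag-1 anchors: the examination fails with probability at most `4((1-δ₂)^K + ε')`** — after a `Valid₂` history, given for every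
onward direction the face-prefix consequences (I3) and the target lemma at the faces (I2) at the fixed anchors `(α, β)`, and the corridor bound
`1 - ε' < P_μ(Reach)` under `μ = Wfull h e α β du` (KN Lemma 12, `E_{v,x}` random). [cite: KozmaNitzan2024, §4 pp. 28–31 ((33), Steps I–IV)] -/
theorem fail_bound₂ (hV : S.Valid₂ G h e) (hSt : StepsGeom S.Γ FD) {ε' δ₂ : ℝ} (hε' : 0 ≤ ε') (hδ₂ : δ₂ ≤ 1)
    (hP1 : ∀ du ∈ S.onward G h (tgt e), ∀ ω,
      ω ∈ KNLevels.lattOnly G (S.Vx G h ∪ S.Γ.Ewv a e.1 e.2 ∪ FD.Hfull a' (tgt e) du) →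
      ω ∈ S.Reach G FD h e a a' du → ω ∈ S.Aface G FD h e a a' du (S.Γ.K - 1))
    (hP2 : ∀ du ∈ S.onward G h (tgt e), ∀ ω j, 1 ≤ j → j < S.Γ.K →
      ω ∈ KNLevels.lattOnly G (S.Vx G h ∪ S.Γ.Ewv a e.1 e.2 ∪ S.Γ.Stub a' (tgt e) du (j + 1)) →
      ω ∈ S.Aface G FD h e a a' du j → ω ∈ S.Aface G FD h e a a' du (j - 1))
    (hface : ∀ du ∈ S.onward G h (tgt e), ∀ j < S.Γ.K, ∀ o : Finset (Sym2 V),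
      1 - δ₂ < (prodBernoulli (S.Wt G h e a a' du j o)).real (⋃ b ∈ FD.Face a' (tgt e) du (j + 1), openConn S.Γ.root b) →
        S.cond G h e a a' du j o)
    (hreach : ∀ du ∈ S.onward G h (tgt e), 1 - ε' < (prodBernoulli (S.Wfull G h e a a' du)).real (S.Reach G FD h e a a' du)) :
    (bondPercolation G S.p).real {ω | ¬S.succ₂ G h e a a' ((S.probe₂ G h e a a').read ω)} ≤ 4 * ((1 - δ₂) ^ S.Γ.K + ε') := by
  have hcard : ((S.onward G h (tgt e)).card : ℝ) ≤ 4 := by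
    have h1 : (S.onward G h (tgt e)).card ≤ Fintype.card MDir := Finset.card_le_univ _
    have h2 : Fintype.card MDir = 4 := by simp [MDir, Fintype.card_prod, Fintype.card_bool, Fintype.card_fin]
    have h3 : (S.onward G h (tgt e)).card ≤ 4 := h2 ▸ h1
    exact_mod_cast h3
  have hK0 : 0 ≤ (1 - δ₂) ^ S.Γ.K + ε' := add_nonneg (pow_nonneg (by linarith) _) hε'
  -- one direction
  have hdir : ∀ du ∈ S.onward G h (tgt e), (bondPercolation G S.p).real (S.badA G h e a a' du) ≤ (1 - δ₂) ^ S.Γ.K + ε' := by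
    intro du hdu
    have hRm : MeasurableSet (S.Reach G FD h e a a' du) := measurableSet_biUnion_openConnIn _ _ _
    rw [real_eq_Wfull_of_determinedBy hSt ha' (determinedBy_badA h e a a' du)]
    have h1 := real_badA_le_core hV.F_eq hV.ξ_sub ha' hdu hSt hδ₂ (hP1 du hdu) (hP2 du hdu) (hface du hdu)
    have h2 : (prodBernoulli (S.Wfull G h e a a' du)).real (S.Reach G FD h e a a' du)ᶜ < ε' := by
      rw [measureReal_compl hRm, probReal_univ]; linarith [hreach du hdu]
    linarith
  calc (bondPercolation G S.p).real {ω | ¬S.succ₂ G h e a a' ((S.probe₂ G h e a a').read ω)}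
      ≤ (bondPercolation G S.p).real (⋃ du ∈ S.onward G h (tgt e), S.badA G h e a a' du) :=
        measureReal_mono (not_succ₂_subset ha') (measure_ne_top _ _)
    _ ≤ ∑ du ∈ S.onward G h (tgt e), (bondPercolation G S.p).real (S.badA G h e a a' du) := measureReal_biUnion_finset_le _ _
    _ ≤ ∑ du ∈ S.onward G h (tgt e), ((1 - δ₂) ^ S.Γ.K + ε') := Finset.sum_le_sum hdir
    _ = (S.onward G h (tgt e)).card * ((1 - δ₂) ^ S.Γ.K + ε') := by rw [Finset.sum_const, nsmul_eq_mul]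
    _ ≤ 4 * ((1 - δ₂) ^ S.Γ.K + ε') := mul_le_mul_of_nonneg_right hcard hK0

end KSchA

end KNCells

end Transplant

end Summit.CriticalPhenomena.PercolationContinuityZ3.Theorems

end
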